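import Summits.BirchSwinnertonDyer.BirchSwinnertonDyer.Theorems.KatoDescentPotSupersingularMemberHullCoreInputsOfFine
import Literature.NumberTheory.EllipticCurves.IwasawaTowerTorsionPotGoodLocal
import HarnessLib

/-!
# CRUX M's HELD CORE PACKAGE FROM NAMED LITERATURE FACTS ONLY: `Kato2004.exists_memberHullZetaCoreInputs` (27962) and the O6 node
# behind M from {`exists_memberHullZetaFineInputs`, H2X⁺, Lim 3.5, Ferrero–Washington, Imai 1975} — no displayed schema left

Seat `bsd-potss-rkm` g30 (prover, cell `bsd-potss`), item stmt-BirchSwinnertonDyer-19196 `ReducibleKatoMember` (crux M, K9 support /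
K8-t′ auto-crux); `--supports … --as helper`; route-free; closes nothing.  HONEST FRAMING: BSD is proved for no curve; nothing is
booked; M stays cite-level.  The prequel `…MemberHullCoreInputsOfFine` (p677595) DISPLAYED Imai's local finiteness as a schema
hypothesis `hImai` (bsd-cm's shape); the cell's common duties want published-but-unformalised inputs as NAMED facts, so this seat
minted `Literature.NumberTheory.EllipticCurves.imai1975_finite_fixedPoints_kerSubgroup_inf_decomp_of_padicValRat_j_nonneg`
(`Literature/NumberTheory/EllipticCurves/IwasawaTowerTorsionPotGoodLocal.lean`, the schema VERBATIM; Imai's Theorem p. 12 over a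
field of good reduction).  This file re-issues §3–§4 of the prequel with that NAME in place of the schema, so that every binder
of the derivation `atoms ⟹ 27962 ⟹ M` is a named Literature constant: {modularity `exists_isNewformOf`,
`Kato2004.exists_memberHullZetaFineInputs`, `Kato2004.exists_iwasawaH2Data_fineSelmerDual_embedding_count`, Lim 2017 Thm. 3.5,
Ferrero–Washington 1979, Imai 1975}.  The per-route typed closers of `FineInputsK9` / `FineInputsKT` (p678048 / p678056) accept
the named fact for their `hImai` binder as is (the fact unfolds to the schema).

References: [Kato2004Asterisque] Thm. 12.5 (pp. 221–222), (14.9.1)–(14.9.3) (pp. 239–240), §14.14 (p. 243), Prop. 14.16 (2)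
(pp. 244–245); [Imai1975] Theorem (p. 12); [Wuthrich2014] Lemma 14; [Lim2017FineSelmer] Thm. 3.5; [FerreroWashington1979].
-/

-- the summit and its single problem are both named `BirchSwinnertonDyer` (registry layout D-0017)
set_option linter.dupNamespace false
set_option autoImplicit false

noncomputable section

open Literature.NumberTheory.EllipticCurves Literature.NumberTheory.EllipticCurves.ModularForms
  Literature.NumberTheory.EllipticCurves.Kato2004 Literature.NumberTheory.EllipticCurves.Rank1Residual.Typed
open WeierstrassCurve Summit.BirchSwinnertonDyer.BirchSwinnertonDyer.Theorems

namespace Summit.BirchSwinnertonDyer.BirchSwinnertonDyer.Theorems.CoreInputsOfFine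

/-- **`exists_memberHullZetaFineInputs → H2X⁺ → Lim 3.5 → FW → Imai 1975 → exists_memberHullZetaCoreInputs`, ALL BINDERS NAMED** —
the prequel's §3 with the Imai schema supplied by the named fact
`imai1975_finite_fixedPoints_kerSubgroup_inf_decomp_of_padicValRat_j_nonneg`.
[cite: Kato2004Asterisque, Thm. 12.5 (3) (p. 222), (14.9.1) (p. 239), (14.9.3) (p. 240), §14.14 (14.14.1)–(14.14.2) (p. 243)] [cite: Imai1975, Theorem (p. 12)] -/
theorem exists_memberHullZetaCoreInputs_of_fineInputs_of_imai (hF : exists_memberHullZetaFineInputs)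
    (hH : exists_iwasawaH2Data_fineSelmerDual_embedding_count)
    (hLim : Lim2017.thm35_fineSelmerDual_moduleFinite_of_classicalMuVanishes_of_le_divisionField)
    (hFW : Literature.NumberTheory.IwasawaTheory.ferreroWashington1979_classicalMuVanishes)
    (hI : imai1975_finite_fixedPoints_kerSubgroup_inf_decomp_of_padicValRat_j_nonneg) :
    exists_memberHullZetaCoreInputs :=
  exists_memberHullZetaCoreInputs_of_fineInputs hF hH hLim hFW fun W _ p _ κ v => hI W p κ v

/-- **THE O6 NODE BEHIND CRUX M FROM SIX NAMED FACTS** — `Rank1Residual.O6.KatoMemberShaBoundOfReducible` from modularity, the hull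
sub-package, H2X⁺, Lim 3.5, Ferrero–Washington and Imai 1975 (no schema, no Poitou–Tate binder, no Gross–Zagier–Kolyvagin).
[cite: Kato2004Asterisque, Thm. 12.5/12.6 (p. 222), Lemma 13.10 (1) (p. 230), Cor. 14.3 / Thm. 14.5 (pp. 235–236), (14.9.1)–(14.9.3) (pp. 239–240), (14.14.1)–(14.14.2) (p. 243), Prop. 14.16 (2) (pp. 244–245)]
[cite: Imai1975, Theorem (p. 12)] [cite: Wuthrich2014, Lemma 14 (p. 396)] -/
theorem katoMemberShaBoundOfReducible_of_newform_of_fineInputs_of_imai (hmod : exists_isNewformOf)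
    (hF : exists_memberHullZetaFineInputs) (hH : exists_iwasawaH2Data_fineSelmerDual_embedding_count)
    (hLim : Lim2017.thm35_fineSelmerDual_moduleFinite_of_classicalMuVanishes_of_le_divisionField)
    (hFW : Literature.NumberTheory.IwasawaTheory.ferreroWashington1979_classicalMuVanishes)
    (hI : imai1975_finite_fixedPoints_kerSubgroup_inf_decomp_of_padicValRat_j_nonneg) :
    Rank1Residual.O6.KatoMemberShaBoundOfReducible :=
  katoMemberShaBoundOfReducible_of_newform_of_fineInputs hmod hF hH hLim hFW fun W _ p _ κ v => hI W p κ v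

/-- **The reducible upper half behind U₀-red from the same named facts** (plus U₀-red's other held inputs as in the prequel).
[cite: Kato2004Asterisque, §14.14 (p. 243), proof of Prop. 14.16 (pp. 244–245)] [cite: Imai1975, Theorem (p. 12)] -/
theorem missingUpperBoundAt_of_fineInputs_of_imai (hne : Kato2004.nonempty_iwasawaH1Data) (hmod : exists_isNewformOf)
    (hF : exists_memberHullZetaFineInputs) (hH : exists_iwasawaH2Data_fineSelmerDual_embedding_count)
    (hLim : Lim2017.thm35_fineSelmerDual_moduleFinite_of_classicalMuVanishes_of_le_divisionField)
    (hFW : Literature.NumberTheory.IwasawaTheory.ferreroWashington1979_classicalMuVanishes)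
    (hI : imai1975_finite_fixedPoints_kerSubgroup_inf_decomp_of_padicValRat_j_nonneg)
    (hCassels : bsdRHS_eq_of_isIsogenous) (hGZK : rank_eq_analyticRank_of_analyticRank_le_one)
    (hmodL : hasEntireLFunction_rat)
    (W : WeierstrassCurve ℚ) [W.IsElliptic] [W.IsGloballyMinimal] (p : ℕ) [Fact p.Prime]
    (hp : p ≠ 2) (hng : ¬ W.HasGoodReductionAtPrime p) (hnm : ¬ W.HasMultiplicativeReductionAtPrime p)
    (hj : 0 ≤ padicValRat p W.j) (hred : ¬ W.HasIrreducibleModPGaloisRep p)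
    (hr : W.analyticRank = 0) : MissingUpperBoundAt W p :=
  missingUpperBoundAt_of_fineInputs hne hmod hF hH hLim hFW (fun W _ p _ κ v => hI W p κ v) hCassels hGZK hmodL
    W p hp hng hnm hj hred hr

end Summit.BirchSwinnertonDyer.BirchSwinnertonDyer.Theorems.CoreInputsOfFine

end
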